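import Mathlib
import HarnessLib
import Summits.Ventures.LatticeQCDFlow.Scoring.AcceptanceMonitorUnbiased

/-!
# LatticeQCDFlow / Scoring — product marginals of an i.i.d. (block-product) law over DISTINCT
# coordinates; functions of disjoint coordinate pairs are uncorrelated

HONEST FRAMING: exact (Metropolis-corrected) sampling algorithms for lattice gauge theory;
figures of merit are autocorrelation/cost numbers at stated couplings and volumes; no
continuum-physics claim.

Venture `LatticeQCDFlow` (cell pub-lqcd), sub-topic `Scoring`; FANOUT row 3 (`s0-u1-a`, S0-B
implementation A, GEN-7).  NEW WORK of the cell (Fubini over the coordinates of a finite product,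
in finite-sum form), not a published result; NO definition is introduced.  The bookkeeping layer
under row 3's `Scoring/PairAcceptanceVariance` (the variance of the pair-min acceptance
statistic); it extends row 8's one-coordinate marginal `Exactness.sum_blockProd_mul_apply`
(`Exactness/QuasiStaticPathKL`) and row 3's two-coordinate marginals
`sum_blockProd_mul_apply_mul_apply` / `sum_blockProd_mul_apply₂` (`Scoring/AcceptanceMonitorUnbiased`)
to any number of distinct coordinates.

## Content (block-product law `blockProd qb` on `Fin m → Z`, every block `qb i` summing to `1`)

* `sum_blockProd_mul_prod_apply` — for an INJECTIVE selection `c : Fin r → Fin m` and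
  one-coordinate factors `g_s`: `E[Π_s g_s(φ_{c s})] = Π_s E_{qb_{c s}} g_s`;
* `sum_blockProd_mul_apply₄` — the case of four pairwise distinct coordinates;
* `apply₂_eq_sum_ite` — indicator expansion of a function of two coordinates;
* `sum_blockProd_mul_apply₂_mul_apply_mul_apply` — `E[F(φ_i, φ_j)·g₃(φ_k)·g₄(φ_l)]` factorises;
* `sum_blockProd_mul_apply₂_mul_apply₂` — **`E[F(φ_i, φ_j)·G(φ_k, φ_l)] = E[F]·E[G]`** for
  pairwise distinct `i, j, k, l` and ANY `F, G : Z → Z → ℝ` — the independence of disjoint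
  coordinate pairs that makes disjoint partner pairs of a U-statistic contribute exactly the
  squared mean.

Elementary (`[folklore]`-level).  NOT CLAIMED: anything probabilistic beyond finite sums; no
measure-theoretic independence statement is made or needed.
-/

namespace Summit.Ventures.LatticeQCDFlow.Scoring

open Finset
open Summit.Ventures.LatticeQCDFlow.Theory2

/-! ### Product marginals of a block-product law over distinct coordinates -/

section Factorisation

variable {Z : Type*} [Fintype Z] {m r : ℕ}

/-- **Product marginal over distinct coordinates.**  For a block-product law with normalised
blocks, an INJECTIVE coordinate selection `c : Fin r → Fin m` and one-coordinate factors `g_s`: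
`Σ_φ (Π_i qb_i(φ_i)) · Π_s g_s(φ_{c s}) = Π_s Σ_z qb_{c s}(z) g_s(z)` — independence of distinct
coordinates, in finite-sum form (Fubini over the coordinates via `Fintype.prod_sum`).
[folklore] -/
theorem sum_blockProd_mul_prod_apply (qb : Fin m → Z → ℝ) (hq1 : ∀ i, ∑ z, qb i z = 1)
    {c : Fin r → Fin m} (hc : Function.Injective c) (g : Fin r → Z → ℝ) :
    ∑ φ : Fin m → Z, blockProd qb φ * ∏ s, g s (φ (c s)) = ∏ s, ∑ z, qb (c s) z * g s z := by
  classical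
  -- the per-coordinate factor collecting the `g s` with `c s = i`
  set G : Fin m → Z → ℝ := fun i z => ∏ s, (if i = c s then g s z else 1) with hGdef
  have hG : ∀ φ : Fin m → Z, ∏ s, g s (φ (c s)) = ∏ i, G i (φ i) := by
    intro φ
    have h : ∏ i, G i (φ i) = ∏ s, ∏ i, (if i = c s then g s (φ i) else 1) := by
      simp only [hGdef]
      exact Finset.prod_comm
    rw [h]
    exact prod_congr rfl fun s _ => (Fintype.prod_ite_eq' (c s) (fun j => g s (φ j))).symm
  have hint : ∀ φ : Fin m → Z,
      blockProd qb φ * ∏ s, g s (φ (c s)) = ∏ i, (qb i (φ i) * G i (φ i)) := by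
    intro φ
    rw [hG φ, prod_mul_distrib]
    rfl
  simp_rw [hint]
  rw [← Fintype.prod_sum (fun i z => qb i z * G i z)]
  -- evaluate the per-coordinate sums
  have hGc : ∀ s z, G (c s) z = g s z := by
    intro s z
    simp only [hGdef]
    have h : ∀ t, (if c s = c t then g t z else 1) = (if t = s then g t z else 1) := by
      intro t
      by_cases ht : t = s
      · subst ht; simp
      · rw [if_neg ht, if_neg (fun e => ht (hc e).symm)]
    simp_rw [h]
    exact Fintype.prod_ite_eq' s (fun t => g t z)
  have hGoff : ∀ i, i ∉ univ.image c → ∀ z, G i z = 1 := by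
    intro i hi z
    simp only [hGdef]
    refine prod_eq_one fun t _ => ?_
    rw [if_neg]
    rintro rfl
    exact hi (mem_image_of_mem c (mem_univ t))
  have hH : ∀ i ∈ (univ : Finset (Fin m)), i ∉ univ.image c → ∑ z, qb i z * G i z = 1 := by
    intro i _ hi
    simp_rw [hGoff i hi, mul_one]
    exact hq1 i
  rw [← prod_subset (subset_univ (univ.image c)) hH, prod_image (fun s _ t _ h => hc h)]
  refine prod_congr rfl fun s _ => ?_
  simp_rw [hGc]

/-- Four pairwise distinct indices give an injective selection `![i, j, k, l]`. -/
theorem injective_vecCons_four {i j k l : Fin m} (hij : i ≠ j) (hik : i ≠ k) (hil : i ≠ l)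
    (hjk : j ≠ k) (hjl : j ≠ l) (hkl : k ≠ l) : Function.Injective ![i, j, k, l] := by
  intro s t h
  fin_cases s <;> fin_cases t <;> simp_all [eq_comm]

/-- **Four-coordinate product marginal**: for pairwise distinct `i, j, k, l`,
`E[g₁(φ_i) g₂(φ_j) g₃(φ_k) g₄(φ_l)] = Π E[g]`. [folklore] -/
theorem sum_blockProd_mul_apply₄ (qb : Fin m → Z → ℝ) (hq1 : ∀ i, ∑ z, qb i z = 1)
    (g₁ g₂ g₃ g₄ : Z → ℝ) {i j k l : Fin m} (hij : i ≠ j) (hik : i ≠ k) (hil : i ≠ l)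
    (hjk : j ≠ k) (hjl : j ≠ l) (hkl : k ≠ l) :
    ∑ φ : Fin m → Z, blockProd qb φ * (g₁ (φ i) * g₂ (φ j) * g₃ (φ k) * g₄ (φ l))
      = (∑ z, qb i z * g₁ z) * (∑ z, qb j z * g₂ z) * (∑ z, qb k z * g₃ z)
          * ∑ z, qb l z * g₄ z := by
  have h := sum_blockProd_mul_prod_apply qb hq1 (injective_vecCons_four hij hik hil hjk hjl hkl)
    ![g₁, g₂, g₃, g₄]
  simpa [Fin.prod_univ_four, mul_assoc] using h

/-- Indicator expansion of a function of two coordinates. [folklore] -/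
theorem apply₂_eq_sum_ite [DecidableEq Z] (F : Z → Z → ℝ) (a b : Z) :
    F a b = ∑ x, ∑ y, F x y * ((if a = x then (1 : ℝ) else 0) * (if b = y then 1 else 0)) := by
  have h1 : ∀ x, ∑ y, F x y * ((if a = x then (1 : ℝ) else 0) * (if b = y then 1 else 0))
      = if a = x then F x b else 0 := by
    intro x
    split_ifs with hx
    · have : ∀ y, F x y * (1 * (if b = y then (1 : ℝ) else 0)) = if b = y then F x y else 0 := by
        intro y; split_ifs <;> ring
      simp_rw [this]
      exact Fintype.sum_ite_eq b (F x)
    · simp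
  simp_rw [h1]
  exact (Fintype.sum_ite_eq a (fun x => F x b)).symm

/-- Mixed marginal: a function of the pair `(φ_i, φ_j)` times one-coordinate factors at two
further distinct coordinates factorises. [folklore] -/
theorem sum_blockProd_mul_apply₂_mul_apply_mul_apply (qb : Fin m → Z → ℝ)
    (hq1 : ∀ i, ∑ z, qb i z = 1) (F : Z → Z → ℝ) (g₃ g₄ : Z → ℝ) {i j k l : Fin m}
    (hij : i ≠ j) (hik : i ≠ k) (hil : i ≠ l) (hjk : j ≠ k) (hjl : j ≠ l) (hkl : k ≠ l) :
    ∑ φ : Fin m → Z, blockProd qb φ * (F (φ i) (φ j) * (g₃ (φ k) * g₄ (φ l)))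
      = (∑ x, ∑ y, qb i x * qb j y * F x y) * (∑ z, qb k z * g₃ z) * ∑ z, qb l z * g₄ z := by
  classical
  have ind : ∀ (t : Fin m) (a : Z), ∑ z, qb t z * (if z = a then (1 : ℝ) else 0) = qb t a := by
    intro t a
    simp_rw [mul_ite, mul_one, mul_zero]
    exact Fintype.sum_ite_eq' a _
  have hφ : ∀ φ : Fin m → Z, blockProd qb φ * (F (φ i) (φ j) * (g₃ (φ k) * g₄ (φ l)))
      = ∑ x, ∑ y, F x y * (blockProd qb φ *
          ((if φ i = x then (1 : ℝ) else 0) * (if φ j = y then 1 else 0) * g₃ (φ k) * g₄ (φ l))) := by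
    intro φ
    conv_lhs => rw [apply₂_eq_sum_ite F (φ i) (φ j)]
    rw [sum_mul, mul_sum]
    refine sum_congr rfl fun x _ => ?_
    rw [sum_mul, mul_sum]
    refine sum_congr rfl fun y _ => ?_
    ring
  calc ∑ φ : Fin m → Z, blockProd qb φ * (F (φ i) (φ j) * (g₃ (φ k) * g₄ (φ l)))
      = ∑ φ : Fin m → Z, ∑ x, ∑ y, F x y * (blockProd qb φ *
          ((if φ i = x then (1 : ℝ) else 0) * (if φ j = y then 1 else 0) * g₃ (φ k) * g₄ (φ l))) :=
        sum_congr rfl fun φ _ => hφ φ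
    _ = ∑ x, ∑ y, F x y * ∑ φ : Fin m → Z, blockProd qb φ *
          ((if φ i = x then (1 : ℝ) else 0) * (if φ j = y then 1 else 0) * g₃ (φ k) * g₄ (φ l)) := by
        rw [sum_comm]
        refine sum_congr rfl fun x _ => ?_
        rw [sum_comm]
        refine sum_congr rfl fun y _ => ?_
        rw [← mul_sum]
    _ = ∑ x, ∑ y, F x y * (qb i x * qb j y * (∑ z, qb k z * g₃ z) * ∑ z, qb l z * g₄ z) := by
        refine sum_congr rfl fun x _ => sum_congr rfl fun y _ => ?_
        rw [sum_blockProd_mul_apply₄ qb hq1 (fun z => if z = x then (1 : ℝ) else 0)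
          (fun z => if z = y then (1 : ℝ) else 0) g₃ g₄ hij hik hil hjk hjl hkl, ind, ind]
    _ = (∑ x, ∑ y, qb i x * qb j y * F x y) * (∑ z, qb k z * g₃ z) * ∑ z, qb l z * g₄ z := by
        rw [sum_mul, sum_mul]
        refine sum_congr rfl fun x _ => ?_
        rw [sum_mul, sum_mul]
        refine sum_congr rfl fun y _ => ?_
        ring

/-- **Functions of disjoint coordinate pairs are uncorrelated**: for pairwise distinct
`i, j, k, l` and any `F, G : Z → Z → ℝ`,
`E[F(φ_i, φ_j)·G(φ_k, φ_l)] = (Σ_xΣ_y qb_i(x) qb_j(y) F(x,y)) · (Σ_xΣ_y qb_k(x) qb_l(y) G(x,y))`.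
[folklore] -/
theorem sum_blockProd_mul_apply₂_mul_apply₂ (qb : Fin m → Z → ℝ) (hq1 : ∀ i, ∑ z, qb i z = 1)
    (F G : Z → Z → ℝ) {i j k l : Fin m} (hij : i ≠ j) (hik : i ≠ k) (hil : i ≠ l)
    (hjk : j ≠ k) (hjl : j ≠ l) (hkl : k ≠ l) :
    ∑ φ : Fin m → Z, blockProd qb φ * (F (φ i) (φ j) * G (φ k) (φ l))
      = (∑ x, ∑ y, qb i x * qb j y * F x y) * ∑ x, ∑ y, qb k x * qb l y * G x y := by
  classical
  have ind : ∀ (t : Fin m) (a : Z), ∑ z, qb t z * (if z = a then (1 : ℝ) else 0) = qb t a := by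
    intro t a
    simp_rw [mul_ite, mul_one, mul_zero]
    exact Fintype.sum_ite_eq' a _
  have hφ : ∀ φ : Fin m → Z, blockProd qb φ * (F (φ i) (φ j) * G (φ k) (φ l))
      = ∑ u, ∑ v, G u v * (blockProd qb φ *
          (F (φ i) (φ j) * ((if φ k = u then (1 : ℝ) else 0) * (if φ l = v then 1 else 0)))) := by
    intro φ
    conv_lhs => rw [apply₂_eq_sum_ite G (φ k) (φ l)]
    rw [mul_sum, mul_sum]
    refine sum_congr rfl fun u _ => ?_
    rw [mul_sum, mul_sum]
    refine sum_congr rfl fun v _ => ?_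
    ring
  calc ∑ φ : Fin m → Z, blockProd qb φ * (F (φ i) (φ j) * G (φ k) (φ l))
      = ∑ φ : Fin m → Z, ∑ u, ∑ v, G u v * (blockProd qb φ *
          (F (φ i) (φ j) * ((if φ k = u then (1 : ℝ) else 0) * (if φ l = v then 1 else 0)))) :=
        sum_congr rfl fun φ _ => hφ φ
    _ = ∑ u, ∑ v, G u v * ∑ φ : Fin m → Z, blockProd qb φ *
          (F (φ i) (φ j) * ((if φ k = u then (1 : ℝ) else 0) * (if φ l = v then 1 else 0))) := by
        rw [sum_comm]
        refine sum_congr rfl fun u _ => ?_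
        rw [sum_comm]
        refine sum_congr rfl fun v _ => ?_
        rw [← mul_sum]
    _ = ∑ u, ∑ v, G u v * ((∑ x, ∑ y, qb i x * qb j y * F x y) * qb k u * qb l v) := by
        refine sum_congr rfl fun u _ => sum_congr rfl fun v _ => ?_
        rw [sum_blockProd_mul_apply₂_mul_apply_mul_apply qb hq1 F
          (fun z => if z = u then (1 : ℝ) else 0) (fun z => if z = v then (1 : ℝ) else 0)
          hij hik hil hjk hjl hkl, ind, ind]
    _ = (∑ x, ∑ y, qb i x * qb j y * F x y) * ∑ u, ∑ v, qb k u * qb l v * G u v := by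
        rw [mul_sum]
        refine sum_congr rfl fun u _ => ?_
        rw [mul_sum]
        refine sum_congr rfl fun v _ => ?_
        ring

end Factorisation

end Summit.Ventures.LatticeQCDFlow.Scoring
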